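import Summits.QuantumFields.YangMills.Theorems.UnitScaleTiltBlockAvgCorrectorEngine
import Literature.MathematicalPhysics.QuantumFieldTheory.Balaban1983to89.BlockAveragingEMLHaarAC
import Literature.MathematicalPhysics.QuantumFieldTheory.Balaban1983to89.LatticeWordStokes
import Literature.MathematicalPhysics.QuantumFieldTheory.Balaban1983to89.T3UnitLawDensityEML
import HarnessLib

/-!
# Route `UnitScaleTilt` (rung R3), crux K1 child «MinimiserStabilityRegPr» (stmt-QuantumFields-19200), stub `stub_smoothLift`
# clause (i), and crux K1bR-pr «FluctuationComparisonRegPr» (stmt-QuantumFields-19201), stub `stub_oneStepSmallLift` / (O):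
# THE EXACT CORRECTOR FOR BAŁABAN'S BLOCK AVERAGING (0.4) WITH THE PRINTED EXP-MEAN-LOG AVERAGE — every coarse field
# near an average IS an average, of a configuration moved only on the private central bonds, with explicit modulus

Cell `ym3-torus` (HUMAN RULING D-0037, YM ladder rung R3), seat `ym3-torus-p1` gen 9 (UV side); cell record HOME/UV3-NODE.md §18.
WHAT THIS IS NOT: not a lift (no approximate smooth lift is constructed here), not a clause of any registered stub by name, and
nothing of Bałaban's is asserted — Bałaban never needs the averaging (0.4) to be ONTO; every declaration is elementary matrix
analysis and lattice combinatorics about the published formula (0.4) of [Balaban1987RG1] p. 253 with the printed inner operation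
`exp[|I|⁻¹ Σ log]` (tree `ExpMeanLog.expMeanLogSU`, guard `δ_N = min(1/3, π/N)`).

THE POINT.  Both located lift stubs of the route — `stub_smoothLift` of 19200 (`T3UpperLiftSplit.SmoothLiftAt`, clause (i)
`D_{K,K+1}U″ = U` EXACTLY) and `stub_oneStepSmallLift` of 19201 (`T3SmallLiftHistory.OneStepSmallLift`: every small `V` IS
`Ū` for a smaller `U`) — and the open-map half (O) of the one-step submersion (`UnitScaleTiltFluctuationComparisonRegPrPosOnSmallReduction`)
need the same engine: an APPROXIMATE preimage (`Ū ≈ V` bond by bond) must be corrected to an EXACT one at a cost linear in the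
defect, uniformly in the volume.  In the tree's private coordinates this is a one-variable problem per coarse bond: the central
crossing bond `β(c)` of the straight line of `c` enters `Ū(c′)` only for `c′ = c` (`BlockAveragingHaarAC`, FACT (A):
`isLocal_avgFun`, `centralBond_injective`), and in `W = pre·U(β(c))·post` the output is the guarded fibre map
`Ū′(c) = exp(Σ_{k off-central} |I|⁻¹ log(h_k W*))·W` (`BlockAveragingEMLHaarAC` §1–2: `avgFun_update_centralBond_self`,
`coe_fibreCore_eq`), whose off-central weights total `1 − N_c/|I| ≤ 1 − |I|⁻¹ < 1`.
* §1 **THE ENGINE** `exists_eq_of_near` (`SU(N)`, any finite weight family of total `≤ 1 − κ`): the map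
  `T W = W·(K W)⁻¹·Y = exp(−Σ…)·Y` is a contraction of the ball `‖W − W₀‖ ≤ 2η/κ` in `SU(N)` with constant
  `(1 − κ)·e^{2r}/(1 − r) ≤ 1 − κ/2` as soon as the data radius `r = r₀ + 2η/κ ≤ κ/16` (mean-value Lipschitz bounds of the
  series logarithm, `FederbushMean.norm_mlog_sub_mlog_le`, and of `exp`, `Literature.Analysis.Complex.norm_exp_sub_exp_le`);
  Banach's fixed point (`ContractingWith.exists_fixedPoint'`, `SU(N)` compact hence complete) solves `K W = Y` with
  `‖W − W₀‖ ≤ 2η/κ` whenever `‖Y − K W₀‖ ≤ η`.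
* §2 **THE CORRECTOR** `exists_avgFun_eq_of_near` (`SU(N)`, every torus in the standing range `j + 1 ≤ m + K`): `PlaqSmall t U`,
  `‖V(c) − Ū(c)‖ ≤ η` for all `c`, `stokesConst·t + 2η|I| ≤ |I|⁻¹/16` and `< δ_N` (`stokesConst = ((d+2)L)²/4` from
  `LatticeWordStokes.dist1_loopHol_le`, `|I| = L^d (d!)²`) ⟹ `V = Ū′` EXACTLY with `U′ = U` off the central bonds and
  `‖U′(b) − U(b)‖ ≤ 2η|I|` (the simultaneous update is `Function.extend centralBond g U`, read output by output through
  `T4TriangularPushforward.apply_resample_eq`); §2b `U′` is `(t + 8η|I|)`-small (`plaqSmall_of_forall_norm_sub_le`: plaquettes are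
  4-Lipschitz in the bonds).
* §3 **THE d = 3 FAMILY ON `SU(2)`** `exists_corrector_T3`: constants depending on the block size alone — `t₀ = (3600(L+1)⁵)⁻¹`,
  `C = 72L³`: `t + Cη ≤ t₀` ⟹ exact correction within `Cη` per bond, `(t + 4Cη)`-small (`|I| = 36L³`, `stokesConst = 25L²/4`,
  guard `1/3`).
So the located content of both lift stubs is now the APPROXIMATE lift alone (for `stub_smoothLift`: the smooth interpolation with
`Ū ≈ U` to second order; for `stub_oneStepSmallLift`: the non-linear reading of the certified linear lift), and (O) follows from
§3 with `δ₁ = t₀/2` (images of open subsets of the `δ₁`-small fields contain a uniform ball about each of their points).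

References: T. Bałaban, CMP 109 (1987) 249–301 [Balaban1987RG1] ((0.4), (0.5)–(0.7), (0.18) p.253–255); CMP 98 (1985) 17–51
[Balaban1985Averaging] ((9) p.19, (19)–(21), (26) p.21–22); CMP 102 (1985) 255–275 [Balaban1985UV3] ((1)–(3) p.256).
-/



noncomputable section

open scoped Matrix.Norms.L2Operator NNReal ENNReal
open NormedSpace Function Set Filter Topology

namespace Summit.QuantumFields.YangMills.Theorems.BlockAvgCorrector

open Literature.MathematicalPhysics.QuantumFieldTheory.Balaban1983to89
open MatrixLog ExpMeanLog

/-! ## §0 `SU(N)` read in `M_N(ℂ)` (local one-liners) -/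

section Matrices

variable {n : Type*} [Fintype n] [DecidableEq n]

/-- A special unitary matrix has operator norm `1` (nonempty index type). [folklore] -/
private theorem norm_coe_su [Nonempty n] (g : Matrix.specialUnitaryGroup n ℂ) : ‖(g : Matrix n n ℂ)‖ = 1 :=
  UnitaryModel.norm_of_mem_unitaryGroup (Matrix.specialUnitaryGroup_le_unitaryGroup g.2)

/-- The inverse in `SU(N)` is the adjoint. [folklore] -/
private theorem coe_inv_su (g : Matrix.specialUnitaryGroup n ℂ) :
    ((g⁻¹ : Matrix.specialUnitaryGroup n ℂ) : Matrix n n ℂ) = star (g : Matrix n n ℂ) := rfl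

/-- Left multiplication by a special unitary does not increase the norm: `‖gA‖ ≤ ‖A‖`. [folklore] -/
private theorem norm_coe_mul_le [Nonempty n] (g : Matrix.specialUnitaryGroup n ℂ) (A : Matrix n n ℂ) :
    ‖(g : Matrix n n ℂ) * A‖ ≤ ‖A‖ :=
  (norm_mul_le _ _).trans (by rw [norm_coe_su, one_mul])

/-- Right multiplication by a special unitary does not increase the norm: `‖Ag‖ ≤ ‖A‖`. [folklore] -/
private theorem norm_mul_coe_le [Nonempty n] (A : Matrix n n ℂ) (g : Matrix.specialUnitaryGroup n ℂ) :
    ‖A * (g : Matrix n n ℂ)‖ ≤ ‖A‖ :=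
  (norm_mul_le _ _).trans (by rw [norm_coe_su, mul_one])

end Matrices

/-! ## §2 The lattice: every coarse field near `Ū` IS an average, of a field moved only on the central bonds -/

section Lattice

open BlockAveraging BlockAveragingHaarAC BlockAveragingEMLHaarAC LatticeWordStokes AveragingRT T4Continuum

variable {P : Params} {j : ℕ} {n : Type*} [Fintype n] [DecidableEq n] [Nonempty n]

/-- In the matrix model `dist1 g = ‖g − 1‖`. [folklore] -/
private theorem dist1_eq (g : Matrix.specialUnitaryGroup n ℂ) : dist1 g = ‖(g : Matrix n n ℂ) - 1‖ := rfl

/-- The lattice-Stokes constant `((d+2)L)²/4` of `LatticeWordStokes.dist1_loopHol_le`: every loop variable of (0.4) of a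
`t`-small field is within `((d+2)L)²/4 · t` of `1`. [cite: Balaban1987RG1, (0.4) p.253] -/
def stokesConst (P : Params) : ℝ := ((((P.d + 2) * P.L : ℕ) : ℝ) ^ 2 / 4)

/-- `stokesConst P ≥ 0`. [folklore] -/
theorem stokesConst_nonneg (P : Params) : 0 ≤ stokesConst P := by unfold stokesConst; positivity

/-- The uniform weight `|I|⁻¹` of (0.4) is positive. [folklore] -/
theorem emlWeight_pos (P : Params) : 0 < emlWeight P :=
  inv_pos.mpr (Nat.cast_pos.mpr Fintype.card_pos)

/-- `|I|⁻¹ ≤ 1`. [folklore] -/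
theorem emlWeight_le_one (P : Params) : emlWeight P ≤ 1 :=
  inv_le_one_of_one_le₀ (by exact_mod_cast Fintype.card_pos (α := Idx P))

/-- The off-central weights at `c` have total `≤ 1 − |I|⁻¹` (there is at least one central index). [folklore] -/
theorem sum_emlWeight_le (c : PBond P (j+1)) : ∑ _k : Fin (offCard c), emlWeight P ≤ 1 - emlWeight P := by
  have hlt := offCard_lt_card c
  have hcard : (0 : ℝ) < Fintype.card (Idx P) := Nat.cast_pos.mpr Fintype.card_pos
  rw [Finset.sum_const, Finset.card_univ, Fintype.card_fin, nsmul_eq_mul, emlWeight]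
  have h1 : ((offCard c : ℕ) : ℝ) ≤ Fintype.card (Idx P) - 1 := by
    have : offCard c + 1 ≤ Fintype.card (Idx P) := hlt
    have := (Nat.cast_le (α := ℝ)).mpr this
    push_cast at this; linarith
  rw [le_sub_iff_add_le]
  calc ((offCard c : ℕ) : ℝ) * ((Fintype.card (Idx P) : ℝ))⁻¹ + ((Fintype.card (Idx P) : ℝ))⁻¹
      = (((offCard c : ℕ) : ℝ) + 1) / Fintype.card (Idx P) := by ring
    _ ≤ (Fintype.card (Idx P) : ℝ) / Fintype.card (Idx P) := div_le_div_of_nonneg_right (by linarith) hcard.le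
    _ = 1 := div_self hcard.ne'

/-- The loop variables at the base point: `‖V_i · W₀* − 1‖ = dist1 (loop variable) ≤ stokesConst · t` for a `t`-small field,
`W₀ = U(c)` the straight transporter. [cite: Balaban1987RG1, (0.4) p.253] -/
theorem norm_openHol_mul_star_sub_one_le {t : ℝ} (ht : 0 ≤ t) {U : GaugeField P j (Matrix.specialUnitaryGroup n ℂ)}
    (hU : PlaqSmall t U) (c : PBond P (j+1)) (i : Idx P) :
    ‖((openHol U c i : Matrix.specialUnitaryGroup n ℂ) : Matrix n n ℂ) * star ((axialAvg U c : Matrix.specialUnitaryGroup n ℂ) : Matrix n n ℂ) - 1‖ ≤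
      stokesConst P * t := by
  have h := dist1_loopHol_le ht hU c i
  rw [loopHol_eq_openHol_mul, dist1_eq, Submonoid.coe_mul, coe_inv_su] at h
  exact h

/-- **THE EXACT CORRECTOR FOR BAŁABAN'S BLOCK AVERAGING (0.4) WITH THE PRINTED EXP-MEAN-LOG AVERAGE ON `SU(N)`.**  On a torus in
the standing range `j + 1 ≤ m + K`: if `U` is `t`-small and the coarse field `V` is `η`-close to `Ū` bond by bond
(`‖V(c) − Ū(c)‖ ≤ η`), with `stokesConst·t + 2η|I| ≤ |I|⁻¹/16` and `< δ_N` (`|I| = L^d(d!)²` the number of loops of (0.4),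
`δ_N` the guard), then `V = Ū′` EXACTLY for a configuration `U′` that agrees with `U` off the central crossing bonds `β(c)`
and moves each of them by at most `2η|I|` in operator norm.  (The coordinates `β(c)` are private and `Ū′(c)` is the guarded
fibre map of §1 in `W = pre·U′(β(c))·post` — `BlockAveragingHaarAC`, `BlockAveragingEMLHaarAC`; the engine `exists_eq_of_near`
solves each fibre equation, and locality (`T4TriangularPushforward.apply_resample_eq`) assembles the simultaneous update.)
NOT PRINTED — Bałaban never needs the averaging to be onto; elementary. [cite: Balaban1987RG1, (0.4) p.253] -/
theorem exists_avgFun_eq_of_near (hj : j + 1 ≤ P.m + P.K) {t η : ℝ} (ht : 0 ≤ t) (hη : 0 ≤ η)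
    (hsmall : stokesConst P * t + 2 * η / emlWeight P ≤ emlWeight P / 16)
    (hguard : stokesConst P * t + 2 * η / emlWeight P < (expMeanLogSU (n := n)).δ)
    (U : GaugeField P j (Matrix.specialUnitaryGroup n ℂ)) (hU : PlaqSmall t U)
    (V : GaugeField P (j+1) (Matrix.specialUnitaryGroup n ℂ))
    (hV : ∀ c, ‖((V c : Matrix.specialUnitaryGroup n ℂ) : Matrix n n ℂ) -
      ((avgFun (expMeanLogSU (n := n)) U c : Matrix.specialUnitaryGroup n ℂ) : Matrix n n ℂ)‖ ≤ η) :
    ∃ U' : GaugeField P j (Matrix.specialUnitaryGroup n ℂ),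
      avgFun (expMeanLogSU (n := n)) U' = V ∧
      (∀ b, (∀ c, centralBond c ≠ b) → U' b = U b) ∧
      ∀ b, ‖((U' b : Matrix.specialUnitaryGroup n ℂ) : Matrix n n ℂ) - (U b : Matrix n n ℂ)‖ ≤ 2 * η / emlWeight P := by
  classical
  have hκ := emlWeight_pos P
  have hκ1 := emlWeight_le_one P
  set R : ℝ := 2 * η / emlWeight P with hR_def
  have hR0 : 0 ≤ R := div_nonneg (by positivity) hκ.le
  have hr₀ : 0 ≤ stokesConst P * t := mul_nonneg (stokesConst_nonneg P) ht
  -- the fibre equation at each coarse bond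
  have hfib : ∀ c : PBond P (j+1), ∃ W : Matrix.specialUnitaryGroup n ℂ,
      ‖(W : Matrix n n ℂ) - ((axialAvg U c : Matrix.specialUnitaryGroup n ℂ) : Matrix n n ℂ)‖ ≤ R ∧
        W ∈ fibreGuard (expMeanLogSU (n := n)) U c ∧
        (expMeanLogSU (n := n)).avg (fibreFamily U c W) * W = V c := by
    intro c
    -- the ball of radius `R` about `W₀ = U(c)` lies in the guard
    have hball : ∀ W : Matrix.specialUnitaryGroup n ℂ,
        ‖(W : Matrix n n ℂ) - ((axialAvg U c : Matrix.specialUnitaryGroup n ℂ) : Matrix n n ℂ)‖ ≤ R →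
          W ∈ fibreGuard (expMeanLogSU (n := n)) U c := by
      intro W hW i
      by_cases hci : IsCentral c i
      · rw [fibreFamily_of_isCentral U c W i hci, GaugeGroup.dist1_one]; exact (expMeanLogSU (n := n)).δ_pos
      · rw [dist1_fibreFamily_of_not_isCentral U c W i hci]
        have h1 : ((openHol U c i : Matrix.specialUnitaryGroup n ℂ) : Matrix n n ℂ) * star (W : Matrix n n ℂ) - 1 =
            (((openHol U c i : Matrix.specialUnitaryGroup n ℂ) : Matrix n n ℂ) * star ((axialAvg U c : Matrix.specialUnitaryGroup n ℂ) : Matrix n n ℂ) - 1) +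
              ((openHol U c i : Matrix.specialUnitaryGroup n ℂ) : Matrix n n ℂ) * star ((W : Matrix n n ℂ) - ((axialAvg U c : Matrix.specialUnitaryGroup n ℂ) : Matrix n n ℂ)) := by
          rw [star_sub]; noncomm_ring
        rw [h1]
        refine (norm_add_le _ _).trans_lt ?_
        have h2 := norm_openHol_mul_star_sub_one_le ht hU c i
        have h3 : ‖((openHol U c i : Matrix.specialUnitaryGroup n ℂ) : Matrix n n ℂ) * star ((W : Matrix n n ℂ) - ((axialAvg U c : Matrix.specialUnitaryGroup n ℂ) : Matrix n n ℂ))‖ ≤ R :=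
          (norm_coe_mul_le _ _).trans (by rw [norm_star]; exact hW)
        linarith
    have hY : ‖((V c : Matrix.specialUnitaryGroup n ℂ) : Matrix n n ℂ) -
        (((expMeanLogSU (n := n)).avg (fibreFamily U c (axialAvg U c)) * axialAvg U c : Matrix.specialUnitaryGroup n ℂ) : Matrix n n ℂ)‖ ≤ η := by
      have h0 : (expMeanLogSU (n := n)).avg (fibreFamily U c (axialAvg U c)) * axialAvg U c = avgFun (expMeanLogSU (n := n)) U c := by
        have hmem : axialAvg U c ∈ fibreGuard (expMeanLogSU (n := n)) U c := hball _ (by rw [sub_self, norm_zero]; exact hR0)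
        rw [← fibreMap_of_mem _ U c hmem, axialAvg_eq_pre_mul_mul_post U c, ← avgFun_update_centralBond_self hj,
          update_eq_self]
      rw [h0]; exact hV c
    obtain ⟨W, hW, hKW⟩ := exists_eq_of_near (offHol U c) (fun _ => emlWeight_nonneg P) hκ hκ1 (sum_emlWeight_le c)
      (K := fun W => (expMeanLogSU (n := n)).avg (fibreFamily U c W) * W) (S := fibreGuard (expMeanLogSU (n := n)) U c)
      (fun W hW => coe_fibreCore_eq U c hW) hr₀ hη hsmall hball
      (fun k => norm_openHol_mul_star_sub_one_le ht hU c _) hY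
    exact ⟨W, hW, hball W hW, hKW⟩
  choose Wc hWR hWG hWK using hfib
  -- the corrected private bonds and the resampled configuration
  set g : PBond P (j+1) → Matrix.specialUnitaryGroup n ℂ := fun c => (pre U c)⁻¹ * Wc c * (post U c)⁻¹ with hg_def
  have hg : ∀ c, pre U c * g c * post U c = Wc c := by
    intro c; simp only [hg_def]; group
  refine ⟨extend centralBond g U, ?_, ?_, ?_⟩
  · funext c
    rw [T4TriangularPushforward.apply_resample_eq (isLocal_avgFun hj _) (centralBond_injective hj) U g c,
      avgFun_update_centralBond_self hj, hg c, fibreMap_of_mem _ U c (hWG c), hWK c]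
  · intro b hb
    exact extend_apply' _ _ _ fun ⟨c, hc⟩ => hb c hc
  · intro b
    by_cases hb : ∃ c, centralBond c = b
    · obtain ⟨c, rfl⟩ := hb
      rw [(centralBond_injective hj).extend_apply]
      have hUc : U (centralBond c) = (pre U c)⁻¹ * axialAvg U c * (post U c)⁻¹ := by
        rw [axialAvg_eq_pre_mul_mul_post]; group
      rw [hUc, hg_def]
      simp only [Submonoid.coe_mul]
      rw [← sub_mul, ← mul_sub]
      exact (norm_mul_coe_le _ _).trans ((norm_coe_mul_le _ _).trans (hWR c))
    · rw [extend_apply' _ _ _ hb, sub_self, norm_zero]; exact hR0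

end Lattice

/-! ## §2b The corrected field stays small: plaquettes move by at most four bond displacements -/

section Plaquettes

open BlockAveraging BlockAveragingHaarAC BlockAveragingEMLHaarAC LatticeWordStokes AveragingRT T4Continuum

variable {P : Params} {j : ℕ} {n : Type*} [Fintype n] [DecidableEq n] [Nonempty n]

/-- `‖g₁g₂ − h₁h₂‖ ≤ ‖g₁ − h₁‖ + ‖g₂ − h₂‖` for special unitaries. [folklore] -/
private theorem norm_coe_mul_sub_mul_le (g₁ g₂ h₁ h₂ : Matrix.specialUnitaryGroup n ℂ) :
    ‖((g₁ * g₂ : Matrix.specialUnitaryGroup n ℂ) : Matrix n n ℂ) - ((h₁ * h₂ : Matrix.specialUnitaryGroup n ℂ) : Matrix n n ℂ)‖ ≤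
      ‖(g₁ : Matrix n n ℂ) - (h₁ : Matrix n n ℂ)‖ + ‖(g₂ : Matrix n n ℂ) - (h₂ : Matrix n n ℂ)‖ := by
  simp only [Submonoid.coe_mul]
  have hid : (g₁ : Matrix n n ℂ) * (g₂ : Matrix n n ℂ) - (h₁ : Matrix n n ℂ) * (h₂ : Matrix n n ℂ) =
      ((g₁ : Matrix n n ℂ) - (h₁ : Matrix n n ℂ)) * (g₂ : Matrix n n ℂ) + (h₁ : Matrix n n ℂ) * ((g₂ : Matrix n n ℂ) - (h₂ : Matrix n n ℂ)) := by
    noncomm_ring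
  rw [hid]
  exact (norm_add_le _ _).trans (add_le_add (norm_mul_coe_le _ _) (norm_coe_mul_le _ _))

omit [Nonempty n] in
/-- `‖g⁻¹ − h⁻¹‖ = ‖g − h‖` for special unitaries. [folklore] -/
private theorem norm_coe_inv_sub_inv (g h : Matrix.specialUnitaryGroup n ℂ) :
    ‖((g⁻¹ : Matrix.specialUnitaryGroup n ℂ) : Matrix n n ℂ) - ((h⁻¹ : Matrix.specialUnitaryGroup n ℂ) : Matrix n n ℂ)‖ =
      ‖(g : Matrix n n ℂ) - (h : Matrix n n ℂ)‖ := by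
  rw [coe_inv_su, coe_inv_su, ← star_sub, norm_star]

/-- **PLAQUETTES ARE 4-LIPSCHITZ IN THE BONDS**: if every bond variable of `U′` is within `ε` of that of `U`, every plaquette
variable of `U′` is within `4ε` of that of `U` (operator norm). [cite: Balaban1985Averaging, (9) p.19] -/
theorem norm_plaqHol_sub_plaqHol_le {U U' : GaugeField P j (Matrix.specialUnitaryGroup n ℂ)} {ε : ℝ}
    (hε : ∀ b, ‖((U' b : Matrix.specialUnitaryGroup n ℂ) : Matrix n n ℂ) - (U b : Matrix n n ℂ)‖ ≤ ε) (p : Plaq P j) :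
    ‖((GaugeField.plaqHol U' p : Matrix.specialUnitaryGroup n ℂ) : Matrix n n ℂ) -
        ((GaugeField.plaqHol U p : Matrix.specialUnitaryGroup n ℂ) : Matrix n n ℂ)‖ ≤ 4 * ε := by
  unfold GaugeField.plaqHol
  have h1 := norm_coe_mul_sub_mul_le (U' ⟨p.src, p.μ⟩ * U' ⟨p.src.shift p.μ, p.ν⟩ * (U' ⟨p.src.shift p.ν, p.μ⟩)⁻¹)
    (U' ⟨p.src, p.ν⟩)⁻¹ (U ⟨p.src, p.μ⟩ * U ⟨p.src.shift p.μ, p.ν⟩ * (U ⟨p.src.shift p.ν, p.μ⟩)⁻¹) (U ⟨p.src, p.ν⟩)⁻¹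
  have h2 := norm_coe_mul_sub_mul_le (U' ⟨p.src, p.μ⟩ * U' ⟨p.src.shift p.μ, p.ν⟩) (U' ⟨p.src.shift p.ν, p.μ⟩)⁻¹
    (U ⟨p.src, p.μ⟩ * U ⟨p.src.shift p.μ, p.ν⟩) (U ⟨p.src.shift p.ν, p.μ⟩)⁻¹
  have h3 := norm_coe_mul_sub_mul_le (U' ⟨p.src, p.μ⟩) (U' ⟨p.src.shift p.μ, p.ν⟩) (U ⟨p.src, p.μ⟩) (U ⟨p.src.shift p.μ, p.ν⟩)
  rw [norm_coe_inv_sub_inv] at h1 h2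
  linarith [hε ⟨p.src, p.μ⟩, hε ⟨p.src.shift p.μ, p.ν⟩, hε ⟨p.src.shift p.ν, p.μ⟩, hε ⟨p.src, p.ν⟩]

/-- **A SMALL MOVE OF THE BONDS KEEPS THE FIELD SMALL**: `PlaqSmall t U` and `‖U′(b) − U(b)‖ ≤ ε` for all `b` give
`PlaqSmall (t + 4ε) U′`. [cite: Balaban1987RG1, (0.18) p.255] -/
theorem plaqSmall_of_forall_norm_sub_le {U U' : GaugeField P j (Matrix.specialUnitaryGroup n ℂ)} {t ε : ℝ}
    (hU : PlaqSmall t U) (hε : ∀ b, ‖((U' b : Matrix.specialUnitaryGroup n ℂ) : Matrix n n ℂ) - (U b : Matrix n n ℂ)‖ ≤ ε) :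
    PlaqSmall (t + 4 * ε) U' := by
  intro p
  have h1 := norm_plaqHol_sub_plaqHol_le hε p
  have h2 := hU p
  rw [dist1_eq] at h2 ⊢
  have h3 : ((GaugeField.plaqHol U' p : Matrix.specialUnitaryGroup n ℂ) : Matrix n n ℂ) - 1 =
      (((GaugeField.plaqHol U' p : Matrix.specialUnitaryGroup n ℂ) : Matrix n n ℂ) - ((GaugeField.plaqHol U p : Matrix.specialUnitaryGroup n ℂ) : Matrix n n ℂ)) +
        (((GaugeField.plaqHol U p : Matrix.specialUnitaryGroup n ℂ) : Matrix n n ℂ) - 1) := by abel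
  rw [h3]
  refine (norm_add_le _ _).trans_lt ?_
  linarith

/-- **THE EXACT CORRECTOR, WITH THE SMALL-FIELD BOOKKEEPING**: under the hypotheses of `exists_avgFun_eq_of_near` the corrected
configuration `U′` (with `Ū′ = V` exactly, `U′ = U` off the central bonds, `‖U′(b) − U(b)‖ ≤ 2η|I|`) is `(t + 8η|I|)`-small.
[cite: Balaban1987RG1, (0.4)/(0.18) p.253] -/
theorem exists_avgFun_eq_of_near' (hj : j + 1 ≤ P.m + P.K) {t η : ℝ} (ht : 0 ≤ t) (hη : 0 ≤ η)
    (hsmall : stokesConst P * t + 2 * η / emlWeight P ≤ emlWeight P / 16)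
    (hguard : stokesConst P * t + 2 * η / emlWeight P < (expMeanLogSU (n := n)).δ)
    (U : GaugeField P j (Matrix.specialUnitaryGroup n ℂ)) (hU : PlaqSmall t U)
    (V : GaugeField P (j+1) (Matrix.specialUnitaryGroup n ℂ))
    (hV : ∀ c, ‖((V c : Matrix.specialUnitaryGroup n ℂ) : Matrix n n ℂ) -
      ((avgFun (expMeanLogSU (n := n)) U c : Matrix.specialUnitaryGroup n ℂ) : Matrix n n ℂ)‖ ≤ η) :
    ∃ U' : GaugeField P j (Matrix.specialUnitaryGroup n ℂ),
      avgFun (expMeanLogSU (n := n)) U' = V ∧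
      (∀ b, (∀ c, centralBond c ≠ b) → U' b = U b) ∧
      (∀ b, ‖((U' b : Matrix.specialUnitaryGroup n ℂ) : Matrix n n ℂ) - (U b : Matrix n n ℂ)‖ ≤ 2 * η / emlWeight P) ∧
      PlaqSmall (t + 4 * (2 * η / emlWeight P)) U' := by
  obtain ⟨U', h1, h2, h3⟩ := exists_avgFun_eq_of_near hj ht hη hsmall hguard U hU V hV
  exact ⟨U', h1, h2, h3, plaqSmall_of_forall_norm_sub_le hU h3⟩

end Plaquettes

/-! ## §3 The d = 3 family on `SU(2)` (route `UnitScaleTilt`): the corrector with constants depending on the block size alone -/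

section Family

open BlockAveraging BlockAveragingHaarAC BlockAveragingEMLHaarAC LatticeWordStokes AveragingRT T4Continuum
open T3ContinuumYM3Torus
open T3UnitLawDensityEML (ℰp)

/-- `|I| = L^d · (d!)²` loops in (0.4). [cite: Balaban1987RG1, (0.4) p.253] -/
theorem card_idx (P : Params) : Fintype.card (Idx P) = P.L ^ P.d * (Nat.factorial P.d) ^ 2 := by
  simp only [Idx, Fintype.card_prod, Fintype.card_fun, Fintype.card_fin, Fintype.card_perm]
  ring

/-- For the d = 3 family, `|I| = 36 L³`. [cite: Balaban1985UV3, (1)-(3) p.256] -/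
theorem card_idx_T3 (F : T3Family) (K : ℕ) : Fintype.card (Idx (F.P K)) = 36 * F.L ^ 3 := by
  rw [card_idx, T3Family.P_d]
  show F.L ^ 3 * (Nat.factorial 3) ^ 2 = 36 * F.L ^ 3
  norm_num [Nat.factorial]
  ring

/-- For the d = 3 family, `|I|⁻¹ = (36 L³)⁻¹`. [cite: Balaban1985UV3, (1)-(3) p.256] -/
theorem emlWeight_T3 (F : T3Family) (K : ℕ) : emlWeight (F.P K) = ((36 : ℝ) * (F.L : ℝ) ^ 3)⁻¹ := by
  rw [emlWeight, card_idx_T3]; push_cast; ring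

/-- For the d = 3 family, the lattice-Stokes constant is `25L²/4`. [cite: Balaban1985UV3, (1)-(3) p.256] -/
theorem stokesConst_T3 (F : T3Family) (K : ℕ) : stokesConst (F.P K) = 25 * (F.L : ℝ) ^ 2 / 4 := by
  rw [stokesConst, T3Family.P_d]
  show (((3 + 2) * F.L : ℕ) : ℝ) ^ 2 / 4 = 25 * (F.L : ℝ) ^ 2 / 4
  push_cast; ring

/-- The guard of the printed exp-mean-log average on `SU(2)` is `1/3`. [cite: Balaban1987RG1, (0.4) p.253] -/
theorem ℰp_δ : (ℰp).δ = 1 / 3 := by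
  show min (1 / 3 : ℝ) (Real.pi / Fintype.card (Fin 2)) = 1 / 3
  rw [Fintype.card_fin]
  exact min_eq_left (by have := Real.pi_gt_three; push_cast; linarith)

/-- **THE EXACT CORRECTOR FOR THE d = 3 FAMILY ON `SU(2)`, CONSTANTS DEPENDING ON `L` ALONE**: for every block size `L` there are
`t₀ = (3600 L⁵)⁻¹ > 0` and `C = 72 L³` such that on every torus of every run of every member of the family with block size `L`
(standing range `j + 1 ≤ m + K`): if `U` is `t`-small, `V` is within `η` of `Ū` bond by bond, and `t + Cη ≤ t₀`, then `V = Ū′`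
EXACTLY for some `U′` equal to `U` off the central bonds, within `Cη` of `U` on every bond, and `(t + 4Cη)`-small.  This is the
exactness step of the smooth one-step lift (crux K1 `stub_smoothLift`, clause (i)) and of the one-step small lift (crux K1bR-pr
`stub_oneStepSmallLift`): any APPROXIMATE lift is corrected to an exact one at a cost linear in the defect.  NOT PRINTED.
[cite: Balaban1987RG1, (0.4)/(0.18) p.253] -/
theorem exists_corrector_T3 (L : ℕ) : ∃ t₀ C : ℝ, 0 < t₀ ∧ 0 ≤ C ∧
    ∀ F : T3Family, F.L = L → ∀ (K j : ℕ), j + 1 ≤ F.m + K →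
      ∀ (t η : ℝ), 0 ≤ t → 0 ≤ η → t + C * η ≤ t₀ →
        ∀ U : GaugeField (F.P K) j (Matrix.specialUnitaryGroup (Fin 2) ℂ), PlaqSmall t U →
          ∀ V : GaugeField (F.P K) (j + 1) (Matrix.specialUnitaryGroup (Fin 2) ℂ),
            (∀ c, ‖((V c : Matrix.specialUnitaryGroup (Fin 2) ℂ) : Matrix (Fin 2) (Fin 2) ℂ) -
              ((avgFun ℰp U c : Matrix.specialUnitaryGroup (Fin 2) ℂ) : Matrix (Fin 2) (Fin 2) ℂ)‖ ≤ η) →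
            ∃ U' : GaugeField (F.P K) j (Matrix.specialUnitaryGroup (Fin 2) ℂ),
              avgFun ℰp U' = V ∧
              (∀ b, (∀ c, centralBond c ≠ b) → U' b = U b) ∧
              (∀ b, ‖((U' b : Matrix.specialUnitaryGroup (Fin 2) ℂ) : Matrix (Fin 2) (Fin 2) ℂ) - (U b : Matrix (Fin 2) (Fin 2) ℂ)‖ ≤ C * η) ∧
              PlaqSmall (t + 4 * (C * η)) U' := by
  refine ⟨((3600 : ℝ) * ((L : ℝ) + 1) ^ 5)⁻¹, 72 * ((L : ℝ)) ^ 3, by positivity, by positivity, ?_⟩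
  intro F hFL K j hj t η ht hη hle U hU V hV
  subst hFL
  have hL1 : (1 : ℝ) ≤ F.L := by exact_mod_cast F.hL.2.le
  have hL : (0 : ℝ) < F.L := by linarith
  -- `2η/|I|⁻¹ = 72 L³ η`
  have hC : 2 * η / emlWeight (F.P K) = 72 * (F.L : ℝ) ^ 3 * η := by
    rw [emlWeight_T3]; field_simp; ring
  -- the smallness hypothesis of the general corrector
  have hsmall : stokesConst (F.P K) * t + 2 * η / emlWeight (F.P K) ≤ emlWeight (F.P K) / 16 := by
    rw [hC, stokesConst_T3, emlWeight_T3]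
    have hS1 : (1 : ℝ) ≤ 25 * (F.L : ℝ) ^ 2 / 4 := by nlinarith
    have h72 : 0 ≤ 72 * (F.L : ℝ) ^ 3 * η := by positivity
    have h1 : 25 * (F.L : ℝ) ^ 2 / 4 * t + 72 * (F.L : ℝ) ^ 3 * η ≤ 25 * (F.L : ℝ) ^ 2 / 4 * (t + 72 * (F.L : ℝ) ^ 3 * η) := by
      nlinarith
    have h2 : t + 72 * (F.L : ℝ) ^ 3 * η ≤ ((3600 : ℝ) * (F.L : ℝ) ^ 5)⁻¹ := by
      refine hle.trans ?_
      rw [inv_le_inv₀ (by positivity) (by positivity)]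
      gcongr; linarith
    calc 25 * (F.L : ℝ) ^ 2 / 4 * t + 72 * (F.L : ℝ) ^ 3 * η ≤ 25 * (F.L : ℝ) ^ 2 / 4 * ((3600 : ℝ) * (F.L : ℝ) ^ 5)⁻¹ :=
          h1.trans (mul_le_mul_of_nonneg_left h2 (by positivity))
      _ = ((36 : ℝ) * (F.L : ℝ) ^ 3)⁻¹ / 16 := by field_simp; ring
  have hguard : stokesConst (F.P K) * t + 2 * η / emlWeight (F.P K) < (ℰp).δ := by
    refine hsmall.trans_lt ?_
    rw [ℰp_δ, emlWeight_T3]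
    have hL3 : (1 : ℝ) ≤ (F.L : ℝ) ^ 3 := one_le_pow₀ hL1
    have : ((36 : ℝ) * (F.L : ℝ) ^ 3)⁻¹ ≤ 1 := inv_le_one_of_one_le₀ (by nlinarith)
    linarith
  obtain ⟨U', h1, h2, h3, h4⟩ := exists_avgFun_eq_of_near' (n := Fin 2) (P := F.P K) hj ht hη hsmall hguard U hU V hV
  refine ⟨U', h1, h2, fun b => ?_, ?_⟩
  · rw [← hC]; exact h3 b
  · rw [← hC]; exact h4

end Family

end Summit.QuantumFields.YangMills.Theorems.BlockAvgCorrector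

end
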